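import Summits.ValiantsHypothesis.ValiantsHypothesis.Theorems.BarrierLeverAnchoredDoorHitsLowerPairsBlockPairing

/-!
# Support item `AnchoredDoorHitsLowerPairs` (stmt-ValiantsHypothesis-22510), line `anchored-peeling`:
# KERNEL LINES — the rank-one case of the block-pairing lemma (module M2′ of the UQ_s-step blueprint, gap m = 1)

Helper file (`--supports stmt-ValiantsHypothesis-22510`; cell valiant-natproofs, rung V4, 𝒟-side door (c); registered line
`Cruxes/AnchoredDoorHitsLowerPairs/Lines/anchored_peeling.lean` v13, whose composition is now `Stmt.stub_uqFaceStep → Stmt.stub_uqFaceResidual → crux`;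
prover seat val-np-p1 gen 19; blueprint HOME/val-np-p1/g19/QSTEP-BLUEPRINT-valnp1-g19.md § «GAP ≤ 1»). Definition-light, pure linear algebra over an
integral domain. Closes NO item.

The block-pairing lemma `det_ne_zero_of_blockPairing` (p615172) asks that EVERY nonzero left-kernel vector `x` of the zero-block pattern pair non-trivially
with some right-kernel vector. In the UQ-step with gap `m = ℓ_F − ℓ_v = 1` both kernels are LINES, spanned by explicit cofactor vectors, and the whole
hypothesis collapses to ONE ring element being nonzero — the value `α ⬝ᵥ S *ᵥ β` whose private-monomial coefficient module M3 computes.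

* `det_ne_zero_of_blockPairing_line` — zero block `S[p,q] = 0`, `p`-rows independent, a vector `α` (supported off `p`, killing the `q`-columns) to which every
  such vector is proportional (`α i • x = x i • α`), and one `y₀` (supported off `q`, with `(S *ᵥ y₀)|_p = 0`) with `α ⬝ᵥ S *ᵥ y₀ ≠ 0` ⟹ `det S ≠ 0`.
* `Matrix.rowCofactor`, `rowCofactor_vecMul` — for `A : Matrix (Fin (n+1)) (Fin n) R` the signed maximal minors `(−1)^i det A[rows ≠ i]` form a left-kernel
  vector (Laplace expansion of the matrix `[A | A·k]` with a repeated column).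
* `vecMul_line_of_minor_ne_zero` — if one maximal minor `det A[rows ≠ i₀]` is nonzero, any two left-kernel vectors of `A` are proportional
  (`x i₀ • x' = x' i₀ • x`); with `rowCofactor_apply_eq` (`rowCofactor A i₀ = ± that minor`) the cofactor vector spans the line.
* `Matrix.colCofactor`, `mulVec_colCofactor`, `mulVec_line_of_minor_ne_zero` — the transposed statements for `E : Matrix (Fin n) (Fin (n+1)) R`.

WHAT THIS IS NOT: no statement about the door; nothing on crux stmt-ValiantsHypothesis-14610 or on `VP` versus `VNP`.
-/

set_option linter.dupNamespace false

namespace Summit.ValiantsHypothesis.ValiantsHypothesis.Theorems.BarrierLever.AnchoredPeeling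

open Matrix

section Line

variable {A : Type*} [CommRing A] [IsDomain A] {m : Type*} [Fintype m] [DecidableEq m]

/-- **Block pairing, rank-one form.** Let `S` be square over an integral domain with `S[p,q] = 0` and independent `p`-rows. Suppose `α` is a vector to which
every `x` supported off `p` with `(x ᵥ* S)|_q = 0` is proportional (`α i • x = x i • α` for all `i`), and `y₀` is supported off `q` with `(S *ᵥ y₀)|_p = 0` and
`α ⬝ᵥ (S *ᵥ y₀) ≠ 0`. Then `det S ≠ 0`. -/
theorem det_ne_zero_of_blockPairing_line (S : Matrix m m A) (p q : m → Prop) [DecidablePred p] [DecidablePred q]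
    (hzero : ∀ i j, p i → q j → S i j = 0)
    (hE : ∀ z : m → A, (∀ i, ¬ p i → z i = 0) → z ᵥ* S = 0 → z = 0)
    (α : m → A) (hline : ∀ x : m → A, (∀ i, p i → x i = 0) → (∀ j, q j → (x ᵥ* S) j = 0) → ∀ i, α i • x = x i • α)
    (y₀ : m → A) (hy₀q : ∀ j, q j → y₀ j = 0) (hy₀p : ∀ i, p i → (S *ᵥ y₀) i = 0) (hval : α ⬝ᵥ (S *ᵥ y₀) ≠ 0) :
    S.det ≠ 0 := by
  refine det_ne_zero_of_blockPairing S p q hzero hE (fun x hxp hxq hx0 => ⟨y₀, hy₀q, hy₀p, ?_⟩)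
  -- pick a coordinate where x is nonzero
  obtain ⟨i, hi⟩ : ∃ i, x i ≠ 0 := by
    by_contra h
    exact hx0 (funext fun i => not_not.mp (not_exists.mp h i))
  have hprop := hline x hxp hxq i
  have hαi : α i ≠ 0 := by
    intro hαi
    rw [hαi, zero_smul] at hprop
    -- x i • α = 0 with x i ≠ 0 forces α = 0, contradicting hval
    have hα0 : α = 0 := by
      funext k
      have := congrFun hprop k
      simp only [Pi.zero_apply, Pi.smul_apply, smul_eq_mul] at this
      exact (mul_eq_zero.mp this.symm).resolve_left hi
    exact hval (by rw [hα0, zero_dotProduct])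
  intro hx
  -- α i • (x ⬝ S y₀) = x i • (α ⬝ S y₀)
  have key : α i * (x ⬝ᵥ (S *ᵥ y₀)) = x i * (α ⬝ᵥ (S *ᵥ y₀)) := by
    rw [← smul_eq_mul, ← smul_eq_mul, ← smul_dotProduct, ← smul_dotProduct, hprop]
  rw [hx, mul_zero] at key
  exact (mul_ne_zero hi hval) key.symm

end Line

section Cofactor

variable {R : Type*} [CommRing R] {n : ℕ}

/-- The signed maximal minors of a tall `(n+1) × n` matrix: `rowCofactor A i = (−1)^i · det A[rows ≠ i]`. -/
def Matrix.rowCofactor (A : Matrix (Fin (n + 1)) (Fin n) R) (i : Fin (n + 1)) : R :=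
  (-1) ^ (i : ℕ) * (A.submatrix i.succAbove id).det

/-- Unfolding lemma for `rowCofactor`. -/
theorem rowCofactor_apply (A : Matrix (Fin (n + 1)) (Fin n) R) (i : Fin (n + 1)) :
    Matrix.rowCofactor A i = (-1) ^ (i : ℕ) * (A.submatrix i.succAbove id).det := rfl

/-- **The cofactor vector is a left-kernel vector**: `Σ_i (−1)^i det A[rows ≠ i] · A i k = 0` for every column `k` (Laplace expansion, along the appended
column, of the square matrix `[A | A·k]`, which has two equal columns). -/
theorem rowCofactor_vecMul (A : Matrix (Fin (n + 1)) (Fin n) R) : Matrix.rowCofactor A ᵥ* A = 0 := by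
  funext k
  rw [Pi.zero_apply]
  change ∑ i, Matrix.rowCofactor A i * A i k = 0
  -- the bordered square matrix
  let B : Matrix (Fin (n + 1)) (Fin (n + 1)) R := Matrix.of fun i j => Fin.lastCases (A i k) (fun j' => A i j') j
  have hBlast : ∀ i, B i (Fin.last n) = A i k := fun i => by
    simp [B]
  have hBcast : ∀ i (j' : Fin n), B i (Fin.castSucc j') = A i j' := fun i j' => by
    simp [B]
  have hBdet : B.det = 0 := by
    refine Matrix.det_zero_of_column_eq (Fin.castSucc_lt_last k).ne (fun i => ?_)
    rw [hBcast, hBlast]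
  have hsub : ∀ i : Fin (n + 1), B.submatrix i.succAbove (Fin.last n).succAbove = A.submatrix i.succAbove id := by
    intro i
    ext a b
    simp only [Matrix.submatrix_apply, id, Fin.succAbove_last]
    exact hBcast _ _
  have hexp := Matrix.det_succ_column B (Fin.last n)
  rw [hBdet] at hexp
  -- hexp : 0 = Σ_i (-1)^(i+n) * B i last * det (...)
  have : ∑ i : Fin (n + 1), Matrix.rowCofactor A i * A i k
      = (-1) ^ (n : ℕ) * ∑ i : Fin (n + 1), (-1) ^ ((i : ℕ) + (Fin.last n : ℕ)) * B i (Fin.last n)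
          * (B.submatrix i.succAbove (Fin.last n).succAbove).det := by
    rw [Finset.mul_sum]
    refine Finset.sum_congr rfl (fun i _ => ?_)
    rw [hsub, hBlast, rowCofactor_apply, Fin.val_last, pow_add]
    have hn : ((-1 : R) ^ (n : ℕ)) ^ 2 = 1 := by rw [← pow_mul, mul_comm, pow_mul, neg_one_sq, one_pow]
    linear_combination (-((-1 : R) ^ (i : ℕ) * (A.submatrix i.succAbove id).det * A i k)) * hn
  rw [this, ← hexp, mul_zero]

/-- The `i₀`-th cofactor is, up to sign, the maximal minor avoiding row `i₀`. -/
theorem rowCofactor_ne_zero_iff [IsDomain R] (A : Matrix (Fin (n + 1)) (Fin n) R) (i₀ : Fin (n + 1)) :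
    Matrix.rowCofactor A i₀ ≠ 0 ↔ (A.submatrix i₀.succAbove id).det ≠ 0 := by
  rw [rowCofactor_apply]
  refine ⟨fun h h0 => h (by rw [h0, mul_zero]), fun h => mul_ne_zero (pow_ne_zero _ (by norm_num)) h⟩

/-- **Left kernels of tall matrices with a nonzero maximal minor are lines.** If `det A[rows ≠ i₀] ≠ 0` then any two vectors `x, x'` with
`x ᵥ* A = 0 = x' ᵥ* A` satisfy `x i₀ • x' = x' i₀ • x`. -/
theorem vecMul_line_of_minor_ne_zero [IsDomain R] (A : Matrix (Fin (n + 1)) (Fin n) R) (i₀ : Fin (n + 1))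
    (hmin : (A.submatrix i₀.succAbove id).det ≠ 0) (x x' : Fin (n + 1) → R) (hx : x ᵥ* A = 0) (hx' : x' ᵥ* A = 0) :
    x i₀ • x' = x' i₀ • x := by
  -- z := x i₀ • x' - x' i₀ • x is a kernel vector vanishing at i₀
  set z : Fin (n + 1) → R := x i₀ • x' - x' i₀ • x with hz
  have hzA : z ᵥ* A = 0 := by
    rw [hz, sub_vecMul, smul_vecMul, smul_vecMul, hx, hx', smul_zero, smul_zero, sub_zero]
  have hz0 : z i₀ = 0 := by
    simp only [hz, Pi.sub_apply, Pi.smul_apply, smul_eq_mul]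
    ring
  -- restrict to the rows ≠ i₀
  have hz' : (z ∘ i₀.succAbove) ᵥ* (A.submatrix i₀.succAbove id) = 0 := by
    funext k
    rw [Pi.zero_apply]
    have hk := congrFun hzA k
    rw [Pi.zero_apply] at hk
    change ∑ i, z i * A i k = 0 at hk
    change ∑ a, z (i₀.succAbove a) * A (i₀.succAbove a) k = 0
    rw [Fin.sum_univ_succAbove _ i₀, hz0, zero_mul, zero_add] at hk
    exact hk
  have hzrest : z ∘ i₀.succAbove = 0 := Matrix.eq_zero_of_vecMul_eq_zero hmin hz'
  have hzall : z = 0 := by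
    funext i
    rcases Fin.eq_self_or_eq_succAbove i₀ i with rfl | ⟨a, rfl⟩
    · exact hz0
    · exact congrFun hzrest a
  rw [hz] at hzall
  exact sub_eq_zero.mp hzall

/-- The signed maximal minors of a wide `n × (n+1)` matrix: `colCofactor E j = (−1)^j · det E[cols ≠ j]`. -/
def Matrix.colCofactor (E : Matrix (Fin n) (Fin (n + 1)) R) (j : Fin (n + 1)) : R :=
  (-1) ^ (j : ℕ) * (E.submatrix id j.succAbove).det

/-- Unfolding lemma for `colCofactor`; it is the row cofactor of the transpose. -/
theorem colCofactor_eq_rowCofactor_transpose (E : Matrix (Fin n) (Fin (n + 1)) R) :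
    Matrix.colCofactor E = Matrix.rowCofactor E.transpose := by
  funext j
  rw [Matrix.colCofactor, rowCofactor_apply, ← Matrix.det_transpose, Matrix.transpose_submatrix]

/-- **The column cofactor vector is a right-kernel vector**: `E *ᵥ colCofactor E = 0`. -/
theorem mulVec_colCofactor (E : Matrix (Fin n) (Fin (n + 1)) R) : E *ᵥ Matrix.colCofactor E = 0 := by
  rw [colCofactor_eq_rowCofactor_transpose, ← Matrix.vecMul_transpose]
  exact rowCofactor_vecMul E.transpose

/-- **Right kernels of wide matrices with a nonzero maximal minor are lines.** If `det E[cols ≠ j₀] ≠ 0` then any two vectors `y, y'` with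
`E *ᵥ y = 0 = E *ᵥ y'` satisfy `y j₀ • y' = y' j₀ • y`. -/
theorem mulVec_line_of_minor_ne_zero [IsDomain R] (E : Matrix (Fin n) (Fin (n + 1)) R) (j₀ : Fin (n + 1))
    (hmin : (E.submatrix id j₀.succAbove).det ≠ 0) (y y' : Fin (n + 1) → R) (hy : E *ᵥ y = 0) (hy' : E *ᵥ y' = 0) :
    y j₀ • y' = y' j₀ • y := by
  refine vecMul_line_of_minor_ne_zero E.transpose j₀ ?_ y y' ?_ ?_
  · rwa [← Matrix.transpose_submatrix, Matrix.det_transpose]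
  · rwa [Matrix.vecMul_transpose]
  · rwa [Matrix.vecMul_transpose]

end Cofactor

end Summit.ValiantsHypothesis.ValiantsHypothesis.Theorems.BarrierLever.AnchoredPeeling
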